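import Literature.NumberTheory.GelbartRogawski1991.LocalDoubledUnitaryUnramifiedCell
import Literature.NumberTheory.Automorphic.UnitaryGroupDoubledIntegralWitness
import HarnessLib

-- buildfix G11b-3 recipe (LEDGER B13-1/B13-3): elaborate sequentially so the trailing `attribute [implicit_reducible]`
-- block (reducibilityCoreExt is keyed to the async environment branch) is in force at `.olean` export.
set_option Elab.async false

/-!
# The unramified clause for the doubled unitary group, III: the residue witness at a good non-split place
# ([GelbartRogawski1991, §3.1 (3.1.3)]; [Kudla1994, §3])

Topic `NumberTheory/GelbartRogawski1991`; namespace
`Literature.NumberTheory.GelbartRogawski1991.UnitaryDualPair.LocalSplitting` (sequel of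
`LocalDoubledUnitaryUnramifiedCell` and of `Automorphic/UnitaryGroupDoubledIntegralWitness`).  KERNEL only; no named
fact, no `sorry`.

At a NON-SPLIT good place `w ∣ v` (`|2|_w = |δ|_w = 1`, `T₀ ∈ GL_n(𝒪_w)`) the ring `E ⊗ F_v` IS the field `E_w`
(evaluation at the one place `w`, tree `LocalRing.evalEquiv`), the conjugation `c ⊗ 1` becomes the valuation-preserving
involution `c_w = galAdicCompletionMap c` of `E_w` (`conjLocal_apply_of_smul_eq`), and for `k ∈ H(𝒪_v)` the adapted
matrix `Y = adapt (matA k)` evaluated at `w` is an element of `U(c_w, antidiag(2T₀, 2T₀))(𝒪_w)`.  Transporting the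
abstract lifting theorem `DoubledUnitary.exists_integral_skew_valuation_det_eq_one` back along `E ⊗ F_v ≃ E_w` gives
**the residue witness** consumed by `omega_eq_self_of_residueWitness`: an integral `T₀`-skew `y` over `E ⊗ F_v` with
`A_k + y C_k ∈ GL_n(𝒪_w)` (`exists_residueWitness`; the residual statement over `𝓀[E_w]` is
`UnitaryGroupDoubledSiegelWitness.exists_skew_isUnit_block₁₁_add` with `θ̄ = δ̄`).  Also: `c ∘ c = 1` on `E` from `c δ = −δ ≠ 0`
(`galConj_apply_apply`), used for the involutivity of `c_w`.  Stage-1 cell `pub-hodgecm`, seat GR-1, brick L7a of the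
[GelbartRogawski1991, Prop. 3.1.1] kernel construction (2026-08-21).
-/

set_option autoImplicit false

noncomputable section

open NumberField IsDedekindDomain Matrix
open scoped ValuativeRel
open Literature.NumberTheory.Automorphic Literature.NumberTheory.Automorphic.UnitaryGroup
open Literature.NumberTheory.Automorphic.DoubledUnitary Literature.NumberTheory.Automorphic.IntegralReduction
open Literature.NumberTheory.GelbartRogawski1991.AdaptedBlocks

namespace Literature.NumberTheory.GelbartRogawski1991.UnitaryDualPair.LocalSplitting

variable (F : Type) [Field F] [NumberField F] (E : Type) [Field E] [NumberField E] [Algebra F E]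
  [Algebra.IsQuadraticExtension F E] (c : E ≃ₐ[F] E)
  {δ : E} (hcδ : c δ = -δ) (hδ : δ ≠ 0) {d : F} (hd : δ * δ = algebraMap F E d)
  (v : HeightOneSpectrum (𝓞 F)) (n : ℕ) {T₀ : Matrix (Fin n) (Fin n) F} (hT₀ : T₀.IsSymm) (hT₀d : IsUnit T₀.det)
  {JD : Matrix (Fin (n + n)) (Fin (n + n)) E} (hJD : JD = (gramD F n T₀).map (algebraMap F E))

/-! ## §1 `c` is an involution; `c ⊗ 1` at a non-split place is `c_w` -/

include hcδ hδ in
/-- **`c (c x) = x`**: `E = F ⊕ F δ` and `c` fixes `F`, negates `δ`. [cite: CasselsFrohlichANT1967, Ch. VII Prop. 1.2] -/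
theorem galConj_apply_apply (x : E) : c (c x) = x := by
  obtain ⟨a, b, rfl⟩ :=
    exists_eq_add_mul_of_isQuadraticExtension E (not_mem_range_algebraMap_of_apply_eq_neg E c hcδ hδ) x
  simp only [map_add, _root_.map_mul, AlgEquiv.commutes, hcδ, map_neg, mul_neg, neg_neg]

/-- **the conjugation of `E_w` at a non-split place** `c_w : E_w →+* E_w`. [cite: CasselsFrohlichANT1967, Ch. VII §1.1] -/
abbrev conjW (w : PlacesOver E v) (hw : c • w.1 = w.1) : w.1.adicCompletion E →+* w.1.adicCompletion E :=
  galAdicCompletionMap c hw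

include hcδ hδ in
/-- **`(c ⊗ 1)(x)_w = c_w(x_w)`** at a non-split place. [cite: CasselsFrohlichANT1967, Ch. VII §1.1] -/
theorem conjLocal_apply_of_smul_eq (w : PlacesOver E v) (hw : c • w.1 = w.1) (x : (LocalRing E v)) :
    conjLocal E c v x w = galAdicCompletionMap c hw (x w) := by
  have key : ∀ (w₁ : PlacesOver E v) (h₁ : c • w₁.1 = w.1),
      galAdicCompletionMap c h₁ (x w₁) = galAdicCompletionMap c hw (x w) := by
    intro w₁ h₁
    have e : w₁ = w := PlacesOver.eq_of_smul_eq c (galConj_ne_one_of_delta F E c hcδ hδ) w hw w₁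
    subst e
    rfl
  rw [conjLocal_apply]
  exact key ⟨c⁻¹ • w.1, under_inv_smul_eq c w⟩ (smul_inv_smul c w.1)

include hcδ hδ in
/-- `c_w` is an involution. [cite: CasselsFrohlichANT1967, Ch. VII §1.1] -/
theorem conjW_conjW (w : PlacesOver E v) (hw : c • w.1 = w.1) (y : w.1.adicCompletion E) :
    conjW F E c v w hw (conjW F E c v w hw y) = y := by
  rw [conjW, galAdicCompletionMap_galAdicCompletionMap,
    galAdicCompletionMap_congr_left E (AlgEquiv.ext (galConj_apply_apply F E c hcδ hδ) : c * c = 1) _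
      (one_smul _ _), galAdicCompletionMap_one]

omit [NumberField F] [Algebra.IsQuadraticExtension F E] in
/-- `c_w` preserves the valuation. [cite: CasselsFrohlichANT1967, Ch. VII §1.1] -/
theorem valuation_conjW (w : PlacesOver E v) (hw : c • w.1 = w.1) (y : w.1.adicCompletion E) :
    ValuativeRel.valuation (w.1.adicCompletion E) (conjW F E c v w hw y) =
      ValuativeRel.valuation (w.1.adicCompletion E) y := by
  have hle : ∀ a b : w.1.adicCompletion E, ValuativeRel.valuation (w.1.adicCompletion E) a ≤ ValuativeRel.valuation _ b ↔
      Valued.v a ≤ Valued.v b := fun a b =>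
    (Valuation.Compatible.vle_iff_le (v := ValuativeRel.valuation (w.1.adicCompletion E)) a b).symm.trans
      (Valuation.Compatible.vle_iff_le (v := (Valued.v : Valuation (w.1.adicCompletion E) (WithZero (Multiplicative ℤ)))) a b)
  refine le_antisymm ?_ ?_
  · rw [hle, valued_galAdicCompletionMap]
  · rw [hle, valued_galAdicCompletionMap]

include hcδ hδ in
/-- matrices: `((M.map (c ⊗ 1)).map ev_w = (M.map ev_w).map c_w`. [cite: CasselsFrohlichANT1967, Ch. VII §1.1] -/
theorem map_conjLocal_map_eval (w : PlacesOver E v) (hw : c • w.1 = w.1) {m m' : Type*} (M : Matrix m m' (LocalRing E v)) :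
    (M.map (conjLocal E c v)).map (Pi.evalRingHom (fun w' : PlacesOver E v => w'.1.adicCompletion E) w) =
      (M.map (Pi.evalRingHom (fun w' : PlacesOver E v => w'.1.adicCompletion E) w)).map (conjW F E c v w hw) := by
  refine Matrix.ext fun i j => ?_
  exact conjLocal_apply_of_smul_eq F E c hcδ hδ v w hw (M i j)

/-! ## §2 The residue witness -/

section Witness

variable (w : PlacesOver E v) (hw : c • w.1 = w.1)

omit [NumberField F] [Algebra.IsQuadraticExtension F E] in
/-- inverses of invertible matrices commute with ring maps. [folklore] -/
private theorem map_nonsing_inv_of_isUnit {R R' : Type*} [CommRing R] [CommRing R'] {m : Type*} [Fintype m] [DecidableEq m]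
    (f : R →+* R') {M : Matrix m m R} (hM : IsUnit M.det) : (M⁻¹).map f = (M.map f)⁻¹ := by
  refine (Matrix.inv_eq_left_inv ?_).symm
  rw [← Matrix.map_mul, Matrix.nonsing_inv_mul M hM, Matrix.map_one f (map_zero f) (map_one f)]

include hcδ hδ hw in
/-- at a non-split place, an element of `E ⊗ F_v` whose `w`-component has valuation `1` is a unit. [cite: CasselsFrohlichANT1967, Ch. II §10] -/
theorem isUnit_of_valuation_apply_eq_one {x : (LocalRing E v)} (hx : ValuativeRel.valuation (w.1.adicCompletion E) (x w) = 1) : IsUnit x := by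
  have hx0 : x w ≠ 0 := fun h => by rw [h, map_zero] at hx; exact zero_ne_one hx
  have hx0' : x ≠ 0 := fun h => hx0 (by rw [h]; rfl)
  obtain ⟨y, hy⟩ := (LocalRing.isField_of_smul_eq c (galConj_ne_one_of_delta F E c hcδ hδ) w hw).mul_inv_cancel hx0'
  exact IsUnit.of_mul_eq_one y hy

include hcδ hδ hT₀ hJD hw in
/-- **THE RESIDUE WITNESS at a good non-split place** (`|2|_w = |δ|_w = 1`, `T₀ ∈ GL_n(𝒪_w)`): every `k ∈ H(𝒪_v)` has an
integral `T₀`-skew `y` with `A_k + y C_k ∈ GL_n(𝒪_w)` (adapted blocks).  This is the input `hwit` of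
`omega_eq_self_of_residueWitness`. [cite: GelbartRogawski1991, §3.1 (3.1.3); Kudla1994, §3] -/
theorem exists_residueWitness
    (h2 : ValuativeRel.valuation (w.1.adicCompletion E) (2 : (w.1.adicCompletion E)) = 1)
    (hδ1 : ValuativeRel.valuation (w.1.adicCompletion E) ((δ : E) : (w.1.adicCompletion E)) = 1)
    (hgram : IsIntegralAt F E v w (gramS F E v n T₀))
    (hgramDet : ValuativeRel.valuation (w.1.adicCompletion E) ((gramS F E v n T₀).det w) = 1)
    (k : UnitaryGroup.localPi E c (n + n) JD v) (hk : k ∈ UnitaryGroup.localInt E c (n + n) JD v) :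
    ∃ y : Matrix (Fin n) (Fin n) (LocalRing E v),
      (y.map (conjLocal E c v))ᵀ * gramS F E v n T₀ + gramS F E v n T₀ * y = 0 ∧ IsIntegralAt F E v w y ∧
      IsUnit (blkA (matA F E c v n k) + y * blkC (matA F E c v n k)).det ∧
      IsIntegralAt F E v w (blkA (matA F E c v n k) + y * blkC (matA F E c v n k))⁻¹ := by
  have hc : c ≠ 1 := galConj_ne_one_of_delta F E c hcδ hδ
  have hσv := valuation_conjW F E c v w hw
  have hσ : ∀ x, conjW F E c v w hw (conjW F E c v w hw x) = x := conjW_conjW F E c hcδ hδ v w hw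
  -- the form `τ = (2T₀)_w`
  have hτ2 : ((2 : (LocalRing E v)) • gramS F E v n T₀).map (Pi.evalRingHom (fun w' : PlacesOver E v => w'.1.adicCompletion E) w) = (2 : (w.1.adicCompletion E)) • (gramS F E v n T₀).map (Pi.evalRingHom (fun w' : PlacesOver E v => w'.1.adicCompletion E) w) :=
    Matrix.ext fun i j => by simp
  have hτSσ : (gramS F E v n T₀).map (conjLocal E c v) = gramS F E v n T₀ :=
    Matrix.ext fun i j => conjLocal_toLocalRing c v _
  have hτσ : (((2 : (LocalRing E v)) • gramS F E v n T₀).map (Pi.evalRingHom (fun w' : PlacesOver E v => w'.1.adicCompletion E) w)).map (conjW F E c v w hw) = ((2 : (LocalRing E v)) • gramS F E v n T₀).map (Pi.evalRingHom (fun w' : PlacesOver E v => w'.1.adicCompletion E) w) := by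
    rw [← map_conjLocal_map_eval F E c hcδ hδ v w hw]
    congr 1
    rw [Matrix.map_smul' _ _ _ (_root_.map_mul _), hτSσ, map_ofNat]
  have hτSs : (gramS F E v n T₀)ᵀ = gramS F E v n T₀ := by
    show ((T₀.map _).map _)ᵀ = _
    rw [← Matrix.transpose_map, ← Matrix.transpose_map, hT₀.eq]
  have hτs : (((2 : (LocalRing E v)) • gramS F E v n T₀).map (Pi.evalRingHom (fun w' : PlacesOver E v => w'.1.adicCompletion E) w))ᵀ = ((2 : (LocalRing E v)) • gramS F E v n T₀).map (Pi.evalRingHom (fun w' : PlacesOver E v => w'.1.adicCompletion E) w) := by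
    rw [hτ2, Matrix.transpose_smul, ← Matrix.transpose_map, hτSs]
  have hτi : ValBound 1 (((2 : (LocalRing E v)) • gramS F E v n T₀).map (Pi.evalRingHom (fun w' : PlacesOver E v => w'.1.adicCompletion E) w)) := by
    intro i j
    rw [hτ2, Matrix.smul_apply, smul_eq_mul, _root_.map_mul, h2, one_mul]
    exact hgram i j
  have hτd : ValuativeRel.valuation (w.1.adicCompletion E) (((2 : (LocalRing E v)) • gramS F E v n T₀).map (Pi.evalRingHom (fun w' : PlacesOver E v => w'.1.adicCompletion E) w)).det = 1 := by
    rw [hτ2, Matrix.det_smul, _root_.map_mul, map_pow, h2, one_pow, one_mul]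
    have : ((gramS F E v n T₀).map (Pi.evalRingHom (fun w' : PlacesOver E v => w'.1.adicCompletion E) w)).det = (gramS F E v n T₀).det w := by
      rw [← RingHom.mapMatrix_apply, ← RingHom.map_det]; rfl
    rw [this]; exact hgramDet
  -- the adapted matrix at `w` and its inverse
  have hYi : ValBound 1 ((adapt (matA F E c v n k)).map (Pi.evalRingHom (fun w' : PlacesOver E v => w'.1.adicCompletion E) w)) :=
    isIntegralAt_adapt F E v n w h2 (isIntegralAt_matA_of_mem_localInt F E c hcδ hδ v n w hw hk)
  have hY'i : ValBound 1 ((adapt (matA F E c v n k⁻¹)).map (Pi.evalRingHom (fun w' : PlacesOver E v => w'.1.adicCompletion E) w)) :=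
    isIntegralAt_adapt F E v n w h2 (isIntegralAt_matA_of_mem_localInt F E c hcδ hδ v n w hw (Subgroup.inv_mem _ hk))
  have hYY' : (adapt (matA F E c v n k)).map (Pi.evalRingHom (fun w' : PlacesOver E v => w'.1.adicCompletion E) w) * (adapt (matA F E c v n k⁻¹)).map (Pi.evalRingHom (fun w' : PlacesOver E v => w'.1.adicCompletion E) w) = 1 := by
    rw [← Matrix.map_mul, ← adapt_mul, matA_mul, mul_inv_cancel, matA_one, adapt_one,
      Matrix.map_one _ (map_zero _) (map_one _)]
  -- unitarity at `w` in the anti-diagonal model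
  have hY : (((adapt (matA F E c v n k)).map (Pi.evalRingHom (fun w' : PlacesOver E v => w'.1.adicCompletion E) w)).map (conjW F E c v w hw))ᵀ * antidiagForm (((2 : (LocalRing E v)) • gramS F E v n T₀).map (Pi.evalRingHom (fun w' : PlacesOver E v => w'.1.adicCompletion E) w)) *
      (adapt (matA F E c v n k)).map (Pi.evalRingHom (fun w' : PlacesOver E v => w'.1.adicCompletion E) w) = antidiagForm (((2 : (LocalRing E v)) • gramS F E v n T₀).map (Pi.evalRingHom (fun w' : PlacesOver E v => w'.1.adicCompletion E) w)) := by
    have hcs := cstar_adapt_mul_antidiag_mul_adapt (cstar_matA F E c v n hJD k)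
    have hJ : (Matrix.fromBlocks 0 ((2 : (LocalRing E v)) • gramS F E v n T₀) ((2 : (LocalRing E v)) • gramS F E v n T₀) 0).map (Pi.evalRingHom (fun w' : PlacesOver E v => w'.1.adicCompletion E) w) =
        antidiagForm (((2 : (LocalRing E v)) • gramS F E v n T₀).map (Pi.evalRingHom (fun w' : PlacesOver E v => w'.1.adicCompletion E) w)) := by
      rw [antidiagForm, Matrix.fromBlocks_map, Matrix.map_zero _ (map_zero _)]
    have h := congrArg (RingHom.mapMatrix (Pi.evalRingHom (fun w' : PlacesOver E v => w'.1.adicCompletion E) w)) hcs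
    rw [_root_.map_mul, _root_.map_mul] at h
    simp only [RingHom.mapMatrix_apply] at h
    rw [hJ, ← Matrix.transpose_map, map_conjLocal_map_eval F E c hcδ hδ v w hw] at h
    exact h
  -- `θ = δ`: `c_w δ = -δ`, a unit at `w`
  have hθ : conjW F E c v w hw ((δ : E) : (w.1.adicCompletion E)) = -((δ : E) : (w.1.adicCompletion E)) := by
    rw [conjW, galAdicCompletionMap_coe_algEquiv, hcδ]
    exact map_neg (algebraMap E (w.1.adicCompletion E)) δ
  -- the abstract lifting theorem
  obtain ⟨yw, hywi, hywskew, hywdet⟩ :=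
    exists_integral_skew_valuation_det_eq_one' (conjW F E c v w hw) hσv hσ h2 hθ hδ1 hτσ hτs hτi hτd hYi hY'i hYY' hY
  -- transport back to `E ⊗ F_v`
  have hyev : (yw.map (LocalRing.evalEquiv F E c v hc w hw).symm).map (Pi.evalRingHom (fun w' : PlacesOver E v => w'.1.adicCompletion E) w) = yw :=
    Matrix.ext fun i j => (LocalRing.evalEquiv F E c v hc w hw).apply_symm_apply (yw i j)
  have hyi : IsIntegralAt F E v w (yw.map (LocalRing.evalEquiv F E c v hc w hw).symm) := by
    change ValBound 1 ((yw.map (LocalRing.evalEquiv F E c v hc w hw).symm).map (Pi.evalRingHom (fun w' : PlacesOver E v => w'.1.adicCompletion E) w))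
    rw [hyev]; exact hywi
  -- blocks at `w`
  have hA : (blkA (matA F E c v n k)).map (Pi.evalRingHom (fun w' : PlacesOver E v => w'.1.adicCompletion E) w) = ((adapt (matA F E c v n k)).map (Pi.evalRingHom (fun w' : PlacesOver E v => w'.1.adicCompletion E) w)).toBlocks₁₁ := by rw [adapt_eq]; rfl
  have hC : (blkC (matA F E c v n k)).map (Pi.evalRingHom (fun w' : PlacesOver E v => w'.1.adicCompletion E) w) = ((adapt (matA F E c v n k)).map (Pi.evalRingHom (fun w' : PlacesOver E v => w'.1.adicCompletion E) w)).toBlocks₂₁ := by rw [adapt_eq]; rfl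
  have hXev : (blkA (matA F E c v n k) + yw.map (LocalRing.evalEquiv F E c v hc w hw).symm * blkC (matA F E c v n k)).map (Pi.evalRingHom (fun w' : PlacesOver E v => w'.1.adicCompletion E) w) =
      ((adapt (matA F E c v n k)).map (Pi.evalRingHom (fun w' : PlacesOver E v => w'.1.adicCompletion E) w)).toBlocks₁₁ + yw * ((adapt (matA F E c v n k)).map (Pi.evalRingHom (fun w' : PlacesOver E v => w'.1.adicCompletion E) w)).toBlocks₂₁ := by
    rw [Matrix.map_add _ (map_add _), Matrix.map_mul, hA, hC, hyev]
  have hXdet : ValuativeRel.valuation (w.1.adicCompletion E)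
      ((blkA (matA F E c v n k) + yw.map (LocalRing.evalEquiv F E c v hc w hw).symm * blkC (matA F E c v n k)).det w) = 1 := by
    have : (blkA (matA F E c v n k) + yw.map (LocalRing.evalEquiv F E c v hc w hw).symm * blkC (matA F E c v n k)).det w =
        ((blkA (matA F E c v n k) + yw.map (LocalRing.evalEquiv F E c v hc w hw).symm * blkC (matA F E c v n k)).map (Pi.evalRingHom (fun w' : PlacesOver E v => w'.1.adicCompletion E) w)).det := by
      rw [← RingHom.mapMatrix_apply, ← RingHom.map_det]; rfl
    rw [this, hXev]; exact hywdet
  have hXu := isUnit_of_valuation_apply_eq_one F E c hcδ hδ v w hw hXdet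
  refine ⟨yw.map (LocalRing.evalEquiv F E c v hc w hw).symm, ?_, hyi, hXu, ?_⟩
  · -- skewness over `E ⊗ F_v`: check at the one place `w`
    have hinj : ∀ P Q : Matrix (Fin n) (Fin n) (LocalRing E v), P.map (Pi.evalRingHom (fun w' : PlacesOver E v => w'.1.adicCompletion E) w) = Q.map (Pi.evalRingHom (fun w' : PlacesOver E v => w'.1.adicCompletion E) w) → P = Q := by
      intro P Q hPQ
      refine Matrix.ext fun i j => (LocalRing.eq_iff_apply_eq c hc w hw _ _).2 ?_
      have := congrFun (congrFun hPQ i) j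
      exact this
    apply hinj
    rw [Matrix.map_add _ (map_add _), Matrix.map_mul, Matrix.map_mul, ← Matrix.transpose_map, map_conjLocal_map_eval F E c hcδ hδ v w hw,
      Matrix.transpose_map, hyev, Matrix.map_zero _ (map_zero _)]
    -- from `τ yw + ywᴴ τ = 0` with `τ = 2 T_w`
    have h := hywskew
    rw [hτ2, Matrix.smul_mul, Matrix.mul_smul, ← smul_add] at h
    have h' := congrArg (fun Z : Matrix (Fin n) (Fin n) (w.1.adicCompletion E) => ⅟(2 : (w.1.adicCompletion E)) • Z) h
    simp only [smul_smul, invOf_mul_self, one_smul, smul_zero] at h'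
    rw [add_comm] at h'
    exact h'
  · -- integrality of the inverse at `w`
    change ValBound 1 (((blkA (matA F E c v n k) + yw.map (LocalRing.evalEquiv F E c v hc w hw).symm * blkC (matA F E c v n k))⁻¹).map (Pi.evalRingHom (fun w' : PlacesOver E v => w'.1.adicCompletion E) w))
    rw [map_nonsing_inv_of_isUnit _ hXu, hXev]
    refine valBound_one_nonsing_inv ?_ hywdet
    obtain ⟨hAi, -, hCi, -⟩ := valBound_toBlocks hYi
    have := hywi.mul hCi; rw [one_mul] at this
    exact hAi.add this

end Witness

/-! ### Build-lane note (ops-buildfix G11b-3 recipe, LEDGER B13-1, 2026-08-21)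
`lean -o` (the hub build lane, never `lean`/the gate check) runs Lean 4.32's library-suggestion indexers
(`Lean.LibrarySuggestions.SymbolFrequency` / `SineQuaNon`, from their `exportEntriesFn`) over the statement of
every local theorem that is not a denied premise; on this family's statements (very large dependent binder
telescopes through the theta-kernel / dual-pair data) that fold runs for tens of minutes to hours and the build
lane kills the job (incident G11b-3, run/shared/lean/ops/buildfix/G11b-3-DOSSIER.md). `isDeniedPremise` skips
`[implicit_reducible]` constants before any fold, and a reducibility status on a *theorem* is inert (Meta never
unfolds `thmInfo`; the kernel ignores the attribute), so the public theorems of this file are tagged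
`[implicit_reducible]` purely to keep them out of that index. Only other effect: they are not offered by
`+suggestions` premise selectors. No statement or proof is changed; superseded if the operator lands a
deny-list form (`HarnessLib.PremiseIndex`). -/
set_option allowUnsafeReducibility true in
attribute [implicit_reducible]
  galConj_apply_apply conjLocal_apply_of_smul_eq conjW_conjW valuation_conjW map_conjLocal_map_eval
  isUnit_of_valuation_apply_eq_one exists_residueWitness

end Literature.NumberTheory.GelbartRogawski1991.UnitaryDualPair.LocalSplitting

end
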